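import Summits.QuantumFields.YangMills.Theorems.HypercubicLimit.Negative.NonTrivialityBridge
import Summits.QuantumFields.YangMills.Theorems.HypercubicLimit.Negative.ExtendByZero
import Literature.MathematicalPhysics.QuantumFieldTheory.OSReconstructionNoE1

/-!
# `HypercubicLimit` — structural support: the truncated OS form is a Gram form; non-triviality is positivity

Support file for crux `stmt-QuantumFields-8646` (`HypercubicLimit`), extracted from the standing disprover's work
file `Cruxes/HypercubicLimit/Disproof.lean` §8; builds on `Negative/NonTrivialityBridge.lean` and the tree's
`OSReconstructionNoE1` (GNS Hilbert space from E2 + translation invariance).  The crux's non-triviality and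
convergence clauses are written out verbatim in the statements.

* `osPair S s a b = 𝔖₂(θa ⊗ b)`, `osTrunc S s a b = 𝔖₂(θa ⊗ b) − 𝔖₁(θa)𝔖₁(b)` (real positive-time `a, b`);
  `psi h s ha = Ψ_a` the OS field vector.
* `osTrunc_eq_inner`: `T(a,b) = ⟪Ψ_a − ⟨Ω,Ψ_a⟩Ω, Ψ_b − ⟨Ω,Ψ_b⟩Ω⟫`; `osTrunc_self` (`T(a,a) = ‖·‖²`),
  `osTrunc_cauchySchwarz` (`|T(a,b)|² ≤ T(a,a) T(b,b)`).
* `twoPointNontrivial_iff_diagonal`: under E2 + translations + `𝔖₀ = 1`, the non-triviality clause for `s` ⇔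
  `T(v,v) > 0` for ONE real positive-time `v`.
* `twoPointNontrivial_iff_lattice_diagonal`: adding the convergence clause, ⇔ the truncated reflection-symmetric
  lattice two-point function `⟨Φ_k(θv)Φ_k(v)⟩ − ⟨Φ_k(θv)⟩⟨Φ_k(v)⟩` of the smeared species converges to a strictly
  positive number for one `v` — the prover's target is a positivity statement, the adversary's a vanishing one.
  [folklore]
-/

noncomputable section

open scoped SchwartzMap ComplexConjugate InnerProductSpace
open MeasureTheory Filter Topology Complex
open Literature.MathematicalPhysics.AQFT Literature.MathematicalPhysics.QuantumLattice
open Literature.MathematicalPhysics.QuantumFieldTheory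

namespace Summit.QuantumFields.YangMills.Theorems.HypercubicLimit.Negative

/-! ## §8 Reflection positivity upgrade: the truncated OS form is a Gram form -/

section OSForm

variable {ι : Type}

/-- `osAdjoint_tensor₁` (auxiliary, see the module docstring). [folklore] -/
theorem osAdjoint_tensor₁ (u : 𝓢((EuclideanSpace ℝ (Fin 4)), ℝ)) : osAdjoint (tensor₁ u) = thetaTensor₁ u := by
  ext x
  rw [osAdjoint_apply, thetaTensor₁_apply, tensor₁_apply, Complex.conj_ofReal]
  rw [Subsingleton.elim (Fin.rev (0 : Fin 1)) 0]

/-- The OS two-point pairing `⟨Ψ_a, Ψ_b⟩ = 𝔖₂(θa ⊗ b)` of two real positive-time one-point functions. [folklore] -/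
def osPair (S : LabelledSchwingerFamily ι (EuclideanSpace ℝ (Fin 4))) (s : ι) (a b : 𝓢((EuclideanSpace ℝ (Fin 4)), ℝ)) : ℂ :=
  S (1 + 1) (fun _ => s) (SchwartzMap.appendTensor (thetaTensor₁ a) (tensor₁ b))

/-- The truncated OS form `T(a,b) = 𝔖₂(θa ⊗ b) − 𝔖₁(θa) 𝔖₁(b)`. [folklore] -/
def osTrunc (S : LabelledSchwingerFamily ι (EuclideanSpace ℝ (Fin 4))) (s : ι) (a b : 𝓢((EuclideanSpace ℝ (Fin 4)), ℝ)) : ℂ :=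
  osPair S s a b - S 1 (fun _ => s) (thetaTensor₁ a) * S 1 (fun _ => s) (tensor₁ b)

variable {S : LabelledSchwingerFamily ι (EuclideanSpace ℝ (Fin 4))} (h : OSReconstructionNoE1 S) (s : ι)

/-- The OS field vector `Ψ_a` of a real positive-time one-point function. [folklore] -/
def psi {a : 𝓢((EuclideanSpace ℝ (Fin 4)), ℝ)} (ha : tsupport a ⊆ {y : (EuclideanSpace ℝ (Fin 4)) | 0 < y 0}) : h.Hilbert :=
  h.fieldVec 1 (fun _ => s) (tensor₁ a) (isTimeOrdered_tensor₁ ha)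

/-- `inner_psi_psi` (auxiliary, see the module docstring). [folklore] -/
theorem inner_psi_psi {a b : 𝓢((EuclideanSpace ℝ (Fin 4)), ℝ)} (ha : tsupport a ⊆ {y : (EuclideanSpace ℝ (Fin 4)) | 0 < y 0})
    (hb : tsupport b ⊆ {y : (EuclideanSpace ℝ (Fin 4)) | 0 < y 0}) : ⟪psi h s ha, psi h s hb⟫_ℂ = osPair S s a b := by
  unfold psi osPair
  rw [h.inner_fieldVec_fieldVec (fun _ => s) (fun _ => s) (isTimeOrdered_tensor₁ ha)
    (isTimeOrdered_tensor₁ hb) (isAppendTensorOf_appendTensor _ _), osAdjoint_tensor₁]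
  simp only [Function.comp_def, append_const]

/-- `inner_vacuum_psi` (auxiliary, see the module docstring). [folklore] -/
theorem inner_vacuum_psi {b : 𝓢((EuclideanSpace ℝ (Fin 4)), ℝ)} (hb : tsupport b ⊆ {y : (EuclideanSpace ℝ (Fin 4)) | 0 < y 0}) :
    ⟪h.vacuum, psi h s hb⟫_ℂ = S 1 (fun _ => s) (tensor₁ b) := by
  have hH : IsAppendTensorOf (n := 0) (m := 1) (tensor₁ b)
      (osAdjoint (OSReconstructionNoE1.vacGen ι 4).fn) (tensor₁ b) := by
    intro x
    erw [osAdjoint_apply]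
    simp only [OSReconstructionNoE1.vacGen]
    erw [SchwartzMap.constOfSubsingleton_apply (D := Fin 0 → (EuclideanSpace ℝ (Fin 4))) (1 : ℂ)]
    rw [map_one, one_mul]
    exact congrArg (tensor₁ b) (funext fun i => congrArg x (Fin.ext (by simp)))
  have key := h.inner_fieldVec_fieldVec (OSReconstructionNoE1.vacGen ι 4).lab (fun _ => s)
    (OSReconstructionNoE1.vacGen ι 4).timeOrdered (isTimeOrdered_tensor₁ hb) hH
  have hl : Fin.append ((OSReconstructionNoE1.vacGen ι 4).lab ∘ Fin.rev) (fun _ : Fin 1 => s) =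
      (fun _ => s : Fin (0 + 1) → ι) := by
    funext i
    induction i using Fin.addCases with
    | left i => exact i.elim0
    | right j => simp
  rw [hl] at key
  exact key

/-- `inner_psi_vacuum` (auxiliary, see the module docstring). [folklore] -/
theorem inner_psi_vacuum {a : 𝓢((EuclideanSpace ℝ (Fin 4)), ℝ)} (ha : tsupport a ⊆ {y : (EuclideanSpace ℝ (Fin 4)) | 0 < y 0}) :
    ⟪psi h s ha, h.vacuum⟫_ℂ = S 1 (fun _ => s) (thetaTensor₁ a) := by
  have hH : IsAppendTensorOf (n := 1) (m := 0) (thetaTensor₁ a)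
      (osAdjoint (tensor₁ a)) (OSReconstructionNoE1.vacGen ι 4).fn := by
    intro x
    rw [osAdjoint_tensor₁]
    simp only [OSReconstructionNoE1.vacGen]
    erw [SchwartzMap.constOfSubsingleton_apply (D := Fin 0 → (EuclideanSpace ℝ (Fin 4))) (1 : ℂ)]
    rw [mul_one]
    exact congrArg (thetaTensor₁ a) (funext fun i => congrArg x (Fin.ext (by simp)))
  have key := h.inner_fieldVec_fieldVec (fun _ => s) (OSReconstructionNoE1.vacGen ι 4).lab
    (isTimeOrdered_tensor₁ ha) (OSReconstructionNoE1.vacGen ι 4).timeOrdered hH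
  have hl : Fin.append ((fun _ : Fin 1 => s) ∘ Fin.rev) (OSReconstructionNoE1.vacGen ι 4).lab =
      (fun _ => s : Fin (1 + 0) → ι) := by
    funext i
    induction i using Fin.addCases with
    | left i => simp
    | right j => exact j.elim0
  rw [hl] at key
  exact key

/-- **The truncated OS form is the Gram form of the vacuum-subtracted field vectors**
`χ_a = Ψ_a − ⟨Ω,Ψ_a⟩ Ω`: `T(a,b) = ⟪χ_a, χ_b⟫`. [folklore] -/
theorem osTrunc_eq_inner (hN : S.IsNormalized) {a b : 𝓢((EuclideanSpace ℝ (Fin 4)), ℝ)} (ha : tsupport a ⊆ {y : (EuclideanSpace ℝ (Fin 4)) | 0 < y 0})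
    (hb : tsupport b ⊆ {y : (EuclideanSpace ℝ (Fin 4)) | 0 < y 0}) :
    osTrunc S s a b =
      ⟪psi h s ha - ⟪h.vacuum, psi h s ha⟫_ℂ • h.vacuum, psi h s hb - ⟪h.vacuum, psi h s hb⟫_ℂ • h.vacuum⟫_ℂ := by
  have hΩ : ⟪h.vacuum, h.vacuum⟫_ℂ = 1 := by
    rw [inner_self_eq_norm_sq_to_K, h.norm_vacuum hN]; simp
  rw [inner_sub_left, inner_sub_right, inner_sub_right, inner_smul_left, inner_smul_left,
    inner_smul_right, inner_smul_right, hΩ, inner_psi_psi, inner_psi_vacuum,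
    inner_vacuum_psi h s ha, inner_vacuum_psi h s hb]
  unfold osTrunc
  ring

/-- The diagonal truncated value is a squared norm: real and non-negative. [folklore] -/
theorem osTrunc_self (hN : S.IsNormalized) {a : 𝓢((EuclideanSpace ℝ (Fin 4)), ℝ)} (ha : tsupport a ⊆ {y : (EuclideanSpace ℝ (Fin 4)) | 0 < y 0}) :
    osTrunc S s a a = ((‖psi h s ha - ⟪h.vacuum, psi h s ha⟫_ℂ • h.vacuum‖ ^ 2 : ℝ) : ℂ) := by
  rw [osTrunc_eq_inner h s hN ha ha, inner_self_eq_norm_sq_to_K]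
  norm_cast

/-- **Cauchy–Schwarz for the truncated OS form** (from E2 + translations + normalisation):
`|T(a,b)|² ≤ T(a,a) · T(b,b)` (and `T(a,a) ≥ 0` real, `osTrunc_self`). [folklore] -/
theorem osTrunc_cauchySchwarz (h : OSReconstructionNoE1 S) (hN : S.IsNormalized) {a b : 𝓢((EuclideanSpace ℝ (Fin 4)), ℝ)}
    (ha : tsupport a ⊆ {y : (EuclideanSpace ℝ (Fin 4)) | 0 < y 0})
    (hb : tsupport b ⊆ {y : (EuclideanSpace ℝ (Fin 4)) | 0 < y 0}) :
    ‖osTrunc S s a b‖ ^ 2 ≤ (osTrunc S s a a).re * (osTrunc S s b b).re := by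
  rw [osTrunc_eq_inner h s hN ha hb, osTrunc_self h s hN ha, osTrunc_self h s hN hb, Complex.ofReal_re,
    Complex.ofReal_re]
  have := norm_inner_le_norm (𝕜 := ℂ) (psi h s ha - ⟪h.vacuum, psi h s ha⟫_ℂ • h.vacuum)
    (psi h s hb - ⟪h.vacuum, psi h s hb⟫_ℂ • h.vacuum)
  nlinarith [norm_nonneg (⟪psi h s ha - ⟪h.vacuum, psi h s ha⟫_ℂ • h.vacuum,
    psi h s hb - ⟪h.vacuum, psi h s hb⟫_ℂ • h.vacuum⟫_ℂ),
    norm_nonneg (psi h s ha - ⟪h.vacuum, psi h s ha⟫_ℂ • h.vacuum),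
    norm_nonneg (psi h s hb - ⟪h.vacuum, psi h s hb⟫_ℂ • h.vacuum)]

end OSForm

/-! ### Consequences: non-triviality is a POSITIVITY statement -/

section Diagonal

variable {ι : Type} {S : LabelledSchwingerFamily ι (EuclideanSpace ℝ (Fin 4))}

/-- `tsupport_thetaTest_pos` (auxiliary, see the module docstring). [folklore] -/
theorem tsupport_thetaTest_pos {u : 𝓢((EuclideanSpace ℝ (Fin 4)), ℝ)} (hu : tsupport u ⊆ {y : (EuclideanSpace ℝ (Fin 4)) | y 0 < 0}) :
    tsupport (thetaTest 4 u) ⊆ {y : (EuclideanSpace ℝ (Fin 4)) | 0 < y 0} := by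
  have hK : IsClosed ((timeReflection 4) ⁻¹' tsupport u) :=
    (isClosed_tsupport _).preimage (timeReflection 4).continuous
  have hsub : Function.support (thetaTest 4 u) ⊆ (timeReflection 4) ⁻¹' tsupport u := by
    intro y hy
    rw [Function.mem_support, thetaTest_apply] at hy
    exact subset_tsupport _ (Function.mem_support.2 hy)
  refine (closure_minimal hsub hK).trans fun y hy => ?_
  have h := hu hy
  simp only [Set.mem_setOf_eq, timeReflection_apply] at h
  simpa using h

/-- `tsupport_thetaTest_neg` (auxiliary, see the module docstring). [folklore] -/
theorem tsupport_thetaTest_neg {v : 𝓢((EuclideanSpace ℝ (Fin 4)), ℝ)} (hv : tsupport v ⊆ {y : (EuclideanSpace ℝ (Fin 4)) | 0 < y 0}) :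
    tsupport (thetaTest 4 v) ⊆ {y : (EuclideanSpace ℝ (Fin 4)) | y 0 < 0} := by
  have hK : IsClosed ((timeReflection 4) ⁻¹' tsupport v) :=
    (isClosed_tsupport _).preimage (timeReflection 4).continuous
  have hsub : Function.support (thetaTest 4 v) ⊆ (timeReflection 4) ⁻¹' tsupport v := by
    intro y hy
    rw [Function.mem_support, thetaTest_apply] at hy
    exact subset_tsupport _ (Function.mem_support.2 hy)
  refine (closure_minimal hsub hK).trans fun y hy => ?_
  have h := hv hy
  simp only [Set.mem_setOf_eq, timeReflection_apply] at h
  simpa using h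

/-- `appendTensor_tensor₁` (auxiliary, see the module docstring). [folklore] -/
theorem appendTensor_tensor₁ (u v : 𝓢((EuclideanSpace ℝ (Fin 4)), ℝ)) :
    SchwartzMap.appendTensor (tensor₁ u) (tensor₁ v) = tensor₂ u v := by
  ext x
  rw [SchwartzMap.appendTensor_apply, tensor₁_apply, tensor₁_apply, tensor₂_apply]
  have h0 : (x ∘ Fin.castAdd 1) 0 = x 0 := congrArg x (Fin.ext rfl)
  have h1 : (x ∘ Fin.natAdd 1) 0 = x 1 := congrArg x (Fin.ext rfl)
  rw [h0, h1]

/-- `thetaTensor₁_thetaTest` (auxiliary, see the module docstring). [folklore] -/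
theorem thetaTensor₁_thetaTest (u : 𝓢((EuclideanSpace ℝ (Fin 4)), ℝ)) : thetaTensor₁ (thetaTest 4 u) = tensor₁ u := by
  unfold thetaTensor₁
  rw [thetaTest_involutive 4 u]

/-- The truncated OS form at `(θu, v)` is the truncated real two-point value of the bridge. [folklore] -/
theorem osTrunc_thetaTest (S : LabelledSchwingerFamily ι (EuclideanSpace ℝ (Fin 4))) (s : ι) (u v : 𝓢((EuclideanSpace ℝ (Fin 4)), ℝ)) :
    osTrunc S s (thetaTest 4 u) v =
      S (1 + 1) (fun _ => s) (tensor₂ u v) - S 1 (fun _ => s) (tensor₁ u) * S 1 (fun _ => s) (tensor₁ v) := by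
  unfold osTrunc osPair
  rw [thetaTensor₁_thetaTest, appendTensor_tensor₁]

/-- **Non-triviality is a positivity statement.** Under E2 + translations + `𝔖₀ = 1`, the crux's
non-triviality clause for the species `s` holds iff for ONE real positive-time `v` the truncated,
reflection-symmetric two-point value `T(v,v) = 𝔖₂(θv ⊗ v) − 𝔖₁(θv)𝔖₁(v) = ‖Ψ_v − ⟨Ω,Ψ_v⟩Ω‖²`
is (strictly) POSITIVE.  (Cauchy–Schwarz: an off-diagonal witness forces a diagonal one.) [folklore] -/
theorem twoPointNontrivial_iff_diagonal (h : OSReconstructionNoE1 S) (hN : S.IsNormalized) (s : ι) :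
    (∃ (F₁ G₁ : 𝓢((Fin 1 → (EuclideanSpace ℝ (Fin 4))), ℂ)) (H₁ : 𝓢((Fin (1 + 1) → (EuclideanSpace ℝ (Fin 4))), ℂ)),
      IsTimeOrdered F₁ ∧ IsTimeOrdered G₁ ∧ IsAppendTensorOf H₁ (osAdjoint F₁) G₁ ∧
        S (1 + 1) (fun _ => s) H₁ ≠ S 1 (fun _ => s) (osAdjoint F₁) * S 1 (fun _ => s) G₁) ↔
      ∃ v : 𝓢((EuclideanSpace ℝ (Fin 4)), ℝ), tsupport v ⊆ {y : (EuclideanSpace ℝ (Fin 4)) | 0 < y 0} ∧ 0 < (osTrunc S s v v).re := by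
  rw [twoPointNontrivial_iff_real]
  constructor
  · rintro ⟨u, v, hu, hv, hne⟩
    have hu' := tsupport_thetaTest_pos hu
    have hT : osTrunc S s (thetaTest 4 u) v ≠ 0 := by rwa [osTrunc_thetaTest, sub_ne_zero]
    have hcs := osTrunc_cauchySchwarz s h hN hu' hv
    have hpos : 0 < ‖osTrunc S s (thetaTest 4 u) v‖ ^ 2 := by positivity
    have ha0 : 0 ≤ (osTrunc S s (thetaTest 4 u) (thetaTest 4 u)).re := by
      rw [osTrunc_self h s hN hu', Complex.ofReal_re]; positivity
    refine ⟨v, hv, ?_⟩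
    by_contra hle
    push Not at hle
    nlinarith
  · rintro ⟨v, hv, hpos⟩
    refine ⟨thetaTest 4 v, v, tsupport_thetaTest_neg hv, hv, ?_⟩
    intro heq
    have h0 : osTrunc S s (thetaTest 4 (thetaTest 4 v)) v = 0 := by
      rw [osTrunc_thetaTest, heq, sub_self]
    rw [thetaTest_involutive 4 v] at h0
    rw [h0] at hpos
    simp at hpos

end Diagonal

/-! ### The lattice form of the positivity criterion -/

section LatticeDiagonal

variable {G : Type} [Group G] [TopologicalSpace G] [IsTopologicalGroup G] [CompactSpace G]
  [MeasurableSpace G] [BorelSpace G]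

/-- **The prover's target, final form.** Under the convergence clause, E2, translation invariance
and `𝔖₀ = 1` (all clauses of the crux), non-triviality of the species `s` is EQUIVALENT to: for
ONE real positive-time `v`, the truncated reflection-symmetric lattice two-point function
`⟨Φ_k(θv) Φ_k(v)⟩ − ⟨Φ_k(θv)⟩⟨Φ_k(v)⟩` of the smeared species converges to a strictly POSITIVE
number.  (The adversary's target: it tends to `0` for every such `v`.) [folklore] -/
theorem twoPointNontrivial_iff_lattice_diagonal (r : LatticeRep G) (sch : SpeciesScheme (YMSpecies G))
    (S : LabelledSchwingerFamily (YMSpecies G) (EuclideanSpace ℝ (Fin 4)))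
    (hconv : (∀ (n : ℕ), n ≠ 0 → ∀ (σ : Fin n → YMSpecies G) (f : Fin n → 𝓢((EuclideanSpace ℝ (Fin 4)), ℝ))
      (F : 𝓢((Fin n → (EuclideanSpace ℝ (Fin 4))), ℂ)), IsTensorOf F (fun i => ofRealTest (f i)) → IsOffDiagonal F →
        Tendsto (fun k : ℕ => ((latticeSchwinger r.ρ sch (fun s => s.F) k n σ f : ℝ) : ℂ))
          atTop (𝓝 (S n σ F))))
    (h : OSReconstructionNoE1 S) (hN : S.IsNormalized) (s : YMSpecies G) :
    (∃ (F₁ G₁ : 𝓢((Fin 1 → (EuclideanSpace ℝ (Fin 4))), ℂ)) (H₁ : 𝓢((Fin (1 + 1) → (EuclideanSpace ℝ (Fin 4))), ℂ)),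
      IsTimeOrdered F₁ ∧ IsTimeOrdered G₁ ∧ IsAppendTensorOf H₁ (osAdjoint F₁) G₁ ∧
        S (1 + 1) (fun _ => s) H₁ ≠ S 1 (fun _ => s) (osAdjoint F₁) * S 1 (fun _ => s) G₁) ↔
      ∃ v : 𝓢((EuclideanSpace ℝ (Fin 4)), ℝ), tsupport v ⊆ {y : (EuclideanSpace ℝ (Fin 4)) | 0 < y 0} ∧ ∃ ℓ : ℝ, 0 < ℓ ∧
      Tendsto (fun k : ℕ =>
          latticeSchwinger r.ρ sch (fun s => s.F) k (1 + 1) (fun _ => s) ![thetaTest 4 v, v] -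
            latticeSchwinger r.ρ sch (fun s => s.F) k 1 (fun _ => s) ![thetaTest 4 v] *
              latticeSchwinger r.ρ sch (fun s => s.F) k 1 (fun _ => s) ![v]) atTop (𝓝 ℓ) := by
  rw [twoPointNontrivial_iff_diagonal h hN s]
  refine exists_congr fun v => and_congr_right fun hv => ?_
  set u := thetaTest 4 v with hu_def
  have hu : tsupport u ⊆ {y : (EuclideanSpace ℝ (Fin 4)) | y 0 < 0} := tsupport_thetaTest_neg hv
  have h2 := hconv (1 + 1) (by norm_num) (fun _ => s) ![u, v] (tensor₂ u v) (isTensorOf_tensor₂ u v)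
    (isOffDiagonal_of_halfSpaces hu hv (isTensorOf_tensor₂ u v))
  have hu1 := hconv 1 one_ne_zero (fun _ => s) ![u] (tensor₁ u) (isTensorOf_tensor₁ u)
    (fun x hx => by obtain ⟨i, j, hij, -⟩ := hx; exact absurd (Subsingleton.elim i j) hij)
  have hv1 := hconv 1 one_ne_zero (fun _ => s) ![v] (tensor₁ v) (isTensorOf_tensor₁ v)
    (fun x hx => by obtain ⟨i, j, hij, -⟩ := hx; exact absurd (Subsingleton.elim i j) hij)
  set f : ℕ → ℝ := fun k =>
    latticeSchwinger r.ρ sch (fun s => s.F) k (1 + 1) (fun _ => s) ![u, v] -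
      latticeSchwinger r.ρ sch (fun s => s.F) k 1 (fun _ => s) ![u] *
        latticeSchwinger r.ρ sch (fun s => s.F) k 1 (fun _ => s) ![v] with hf
  have hT0 : osTrunc S s v v =
      S (1 + 1) (fun _ => s) (tensor₂ u v) - S 1 (fun _ => s) (tensor₁ u) * S 1 (fun _ => s) (tensor₁ v) := by
    rw [← osTrunc_thetaTest S s u v, hu_def, thetaTest_involutive 4 v]
  have hT : Tendsto (fun k : ℕ => (f k : ℂ)) atTop (𝓝 (osTrunc S s v v)) := by
    rw [hT0]
    exact (h2.sub (hu1.mul hv1)).congr fun k => by simp only [hf]; push_cast; ring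
  have hre : Tendsto f atTop (𝓝 (osTrunc S s v v).re) := by
    have := (Complex.continuous_re.tendsto _).comp hT
    simpa [Function.comp_def] using this
  change _ ↔ ∃ ℓ : ℝ, 0 < ℓ ∧ Tendsto f atTop (𝓝 ℓ)
  constructor
  · intro hpos
    exact ⟨_, hpos, hre⟩
  · rintro ⟨ℓ, hℓ, hfℓ⟩
    rwa [tendsto_nhds_unique hre hfℓ]

end LatticeDiagonal

end Summit.QuantumFields.YangMills.Theorems.HypercubicLimit.Negative
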